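import Literature.Algebra.Polynomial.CircuitOptimalConstant

/-!
# Circuit polynomials on the standard simplex: `b₀ + ∑ b_j x_j^{2d} + c x^y`

[cite: IlimanDewolff2016, §5 («by setting α(j) = 2d · e_j for 1 ≤ j ≤ n, we recover the
dehomogenized version of what is called an elementary diagonal minus tail form in
[Fidalgo:Kovacec], and, again, Theorems 3.8 and 5.2 generalize one of the main results in
[Fidalgo:Kovacec] to arbitrary simplices»), Theorem 3.8, Example 2.8 («The standard (Hurwitz-)
simplex given by conv{0, 2d·e_1, …, 2d·e_n}»)]
[cite: IlimanDewolff2016GP, §1 («In [Fidalgo:Kovacec], Fidalgo and Kovacec consider the class of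
polynomials, whose Newton polytope is a scaling of the standard simplex conv{0, 2d·e_1, …, 2d·e_n}.
For these polynomials they provide certificates … In [GP] Ghasemi and Marshall show that these
certificates can be translated into checking feasibility of a geometric program»), Corollary 13]

The circuit whose outer vertices are the scaled standard simplex `{0, 2d e_1, …, 2d e_n}` and whose
inner lattice point is `y ∈ ℕⁿ` with `y_i ≥ 1`, `∑ y_i < 2d` carries the polynomials
`p(x) = b₀ + ∑_j b_j x_j^{2d} + c x^y` — dehomogenised elementary «diagonal minus tail» forms.  The
barycentric weights are explicit, `λ_j = y_j/(2d)`, `λ₀ = 1 − |y|/(2d)`, so the companion files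
give, with `Θ = (b₀/λ₀)^{λ₀} ∏_j (b_j/λ_j)^{λ_j}`:

* `p ≥ 0 on ℝⁿ ⟺ (c ≥ 0 ∧ y ∈ (2ℕ)ⁿ) ∨ |c| ≤ Θ` (`diagonal_nonneg_iff`);
* for proper `p` (`c ≠ 0`; `c < 0` or some `y_i` odd): `min p = b₀(1 − (|c|/Θ)^{1/λ₀})`, attained
  (`isLeast_diagonal`).

The affine independence of `{0, 2d e_j}` (`affineIndependent_stdSimplex`) is the only geometric
input.  Instance: `1 + x⁴ + y⁴ + c x y ≥ 0 on ℝ² ⟺ |c| ≤ 2√2`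
(`one_add_pow_four_add_pow_four_add_mul_nonneg_iff`; `λ = (½, ¼, ¼)`,
`Θ = 2^{1/2} 4^{1/4} 4^{1/4}`).

All statements are fully proved; no named facts are introduced.
-/

namespace Literature.Algebra.Polynomial.CircuitDiagonalMinusTail

open Finset Matrix Literature.Algebra.Polynomial.CircuitNumberNonnegativity
open Literature.Algebra.Polynomial.CircuitNormMinimiser
open Literature.Algebra.Polynomial.CircuitOptimalConstant

variable {n : Type*} [Fintype n] [DecidableEq n]

/-- A monomial with a single active variable: `∏_i x_i^{[i = j]·m} = x_j^m`. [folklore] -/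
private theorem prod_pow_ite_eq (x : n → ℝ) (j : n) (m : ℕ) :
    ∏ i, x i ^ (if i = j then m else 0) = x j ^ m := by
  have h : ∀ i, x i ^ (if i = j then m else 0) = if i = j then x i ^ m else 1 := by
    intro i
    split_ifs <;> simp
  simp_rw [h]
  rw [prod_ite_eq']
  simp

/-- Evaluation of the circuit form on the standard simplex: outer exponents `0` (index `none`) and
`2d e_j` (index `some j`), coefficients `b₀, b_j`, inner exponent `y`:
`∑_o b_o x^{α(o)} + c x^y = b₀ + ∑_j b_j x_j^{2d} + c x^y`.
[cite: IlimanDewolff2016, §5 (α(j) = 2d · e_j)] -/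
theorem eval_diagonal (b₀ : ℝ) (b : n → ℝ) (d : ℕ) (c : ℝ) (y : n → ℕ) (x : n → ℝ) :
    ∑ o : Option n, (Option.elim o b₀ b)
        * ∏ i, x i ^ (Option.elim o (fun _ => 0) (fun j i => if i = j then 2 * d else 0) i)
      + c * ∏ i, x i ^ y i
      = b₀ + ∑ j, b j * x j ^ (2 * d) + c * ∏ i, x i ^ y i := by
  rw [Fintype.sum_option]
  simp only [Option.elim_none, Option.elim_some, pow_zero, prod_const_one, mul_one]
  simp_rw [prod_pow_ite_eq]

omit [Fintype n] in
/-- **The vertices `0, 2d e_1, …, 2d e_n` of the scaled standard simplex are affinely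
independent** (`d ≠ 0`): the differences `2d e_j − 0` are linearly independent.
[cite: IlimanDewolff2016, Example 2.8 (the standard (Hurwitz-)simplex)] -/
theorem affineIndependent_stdSimplex {d : ℕ} (hd : d ≠ 0) :
    AffineIndependent ℝ (fun (o : Option n) (i : n) =>
      ((Option.elim o (fun _ => 0) (fun j i => if i = j then 2 * d else 0) i : ℕ) : ℝ)) := by
  rw [affineIndependent_iff_linearIndependent_vsub ℝ _ none]
  have hv : LinearIndependent ℝ fun j : n => Pi.single (M := fun _ : n => ℝ) j ((2 * d : ℕ) : ℝ) :=
    Pi.linearIndependent_single_of_ne_zero fun j => by exact_mod_cast (by omega : 2 * d ≠ 0)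
  let f : {o : Option n // o ≠ none} → n := fun o => o.1.get (Option.ne_none_iff_isSome.mp o.2)
  have hf : Function.Injective f := by
    intro o o' h
    apply Subtype.ext
    rw [← Option.some_get (Option.ne_none_iff_isSome.mp o.2),
      ← Option.some_get (Option.ne_none_iff_isSome.mp o'.2)]
    exact congrArg some h
  have heq : (fun o : {o : Option n // o ≠ none} =>
      ((fun (o : Option n) (i : n) =>
          ((Option.elim o (fun _ => 0) (fun j i => if i = j then 2 * d else 0) i : ℕ) : ℝ)) o
        -ᵥ (fun (o : Option n) (i : n) =>
          ((Option.elim o (fun _ => 0) (fun j i => if i = j then 2 * d else 0) i : ℕ) : ℝ))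
            none))
      = (fun j : n => Pi.single (M := fun _ : n => ℝ) j ((2 * d : ℕ) : ℝ)) ∘ f := by
    funext o
    obtain ⟨o, ho⟩ := o
    obtain ⟨j, rfl⟩ := Option.ne_none_iff_exists'.mp ho
    funext i
    simp [f, Pi.single_apply]
  rw [heq]
  exact hv.comp f hf

omit [DecidableEq n] in
/-- The circuit number of the configuration: `Θ = (b₀/λ₀)^{λ₀} ∏_j (b_j/λ_j)^{λ_j}`.
[cite: IlimanDewolff2016, Theorem 3.8 (Θ_f)] -/
theorem circuitNumber_diagonal (b₀ : ℝ) (b : n → ℝ) (w₀ : ℝ) (w : n → ℝ) :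
    circuitNumber (fun o : Option n => Option.elim o b₀ b) (fun o => Option.elim o w₀ w)
      = (b₀ / w₀) ^ w₀ * ∏ j, (b j / w j) ^ w j := by
  rw [circuitNumber, Fintype.prod_option]
  simp

/-- **Nonnegativity on the standard simplex circuit.**  Let `d ≥ 1`, `y ∈ ℕⁿ` with weights
`λ_j = y_j/(2d) > 0` and `λ₀ = 1 − ∑ λ_j > 0` (i.e. `y_i ≥ 1`, `|y| < 2d`), `b₀, b_j > 0`.  Then
`b₀ + ∑_j b_j x_j^{2d} + c x^y ≥ 0 on ℝⁿ`
`⟺ (c ≥ 0 ∧ y ∈ (2ℕ)ⁿ) ∨ |c| ≤ (b₀/λ₀)^{λ₀} ∏ (b_j/λ_j)^{λ_j}`.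
[cite: IlimanDewolff2016, Theorem 3.8 with §5 (elementary diagonal minus tail forms of
[Fidalgo:Kovacec])] [cite: IlimanDewolff2016GP, §1] -/
theorem diagonal_nonneg_iff {b₀ : ℝ} {b : n → ℝ} (hb₀ : 0 < b₀) (hb : ∀ j, 0 < b j) {d : ℕ}
    (hd : d ≠ 0) {y : n → ℕ} {w₀ : ℝ} {w : n → ℝ} (hw₀ : 0 < w₀) (hw : ∀ j, 0 < w j)
    (hsum : w₀ + ∑ j, w j = 1) (hy : ∀ j, (y j : ℝ) = w j * (2 * d)) (c : ℝ) :
    (∀ x : n → ℝ, 0 ≤ b₀ + ∑ j, b j * x j ^ (2 * d) + c * ∏ i, x i ^ y i) ↔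
      (0 ≤ c ∧ ∀ i, Even (y i)) ∨ |c| ≤ (b₀ / w₀) ^ w₀ * ∏ j, (b j / w j) ^ w j := by
  have hB : ∀ o : Option n, 0 < Option.elim o b₀ b := by
    intro o; cases o <;> simp [hb₀, hb]
  have hW : ∀ o : Option n, 0 < Option.elim o w₀ w := by
    intro o; cases o <;> simp [hw₀, hw]
  have hW1 : ∑ o : Option n, Option.elim o w₀ w = 1 := by
    rw [Fintype.sum_option]; simpa using hsum
  have ha : ∀ (o : Option n) (i : n),
      Even (Option.elim o (fun _ => 0) (fun j i => if i = j then 2 * d else 0) i) := by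
    intro o i; cases o
    · exact ⟨0, rfl⟩
    · simp only [Option.elim_some]
      split_ifs
      · exact ⟨d, by ring⟩
      · exact ⟨0, rfl⟩
  have hβ : ∀ i : n, (y i : ℝ) = ∑ o : Option n, Option.elim o w₀ w
      * ((Option.elim o (fun _ => 0) (fun j i => if i = j then 2 * d else 0) i : ℕ) : ℝ) := by
    intro i
    rw [Fintype.sum_option]
    simp only [Option.elim_none, Option.elim_some, Nat.cast_zero, mul_zero, zero_add]
    have h : ∀ j : n, w j * ((if i = j then 2 * d else 0 : ℕ) : ℝ)
        = if i = j then w i * (2 * d) else 0 := by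
      intro j
      split_ifs with hij
      · subst hij; push_cast; ring
      · simp
    simp_rw [h]
    rw [sum_ite_eq, if_pos (mem_univ i), hy i]
  have key := circuitPolynomial_nonneg_iff' hB hW hW1 ha (affineIndependent_stdSimplex hd) hβ
    (c := c)
  simp_rw [eval_diagonal] at key
  rw [circuitNumber_diagonal] at key
  exact key

/-- **Minimum on the standard simplex circuit in closed form**: for proper `p` (`c ≠ 0`; `c < 0` or
some `y_i` odd), `min_{ℝⁿ} (b₀ + ∑ b_j x_j^{2d} + c x^y) = b₀ (1 − (|c|/Θ)^{1/λ₀})`, attained.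
[cite: IlimanDewolff2016GP, Corollary 13 (f_gp = f*) / Corollary 17 (f_gp = f_0 − m*) — the
standard-simplex case is Ghasemi–Marshall's geometric program, §1] -/
theorem isLeast_diagonal {b₀ : ℝ} {b : n → ℝ} (hb₀ : 0 < b₀) (hb : ∀ j, 0 < b j) {d : ℕ}
    (hd : d ≠ 0) {y : n → ℕ} {w₀ : ℝ} {w : n → ℝ} (hw₀ : 0 < w₀) (hw : ∀ j, 0 < w j)
    (hsum : w₀ + ∑ j, w j = 1) (hy : ∀ j, (y j : ℝ) = w j * (2 * d)) {c : ℝ} (hc0 : c ≠ 0)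
    (hprop : c < 0 ∨ ∃ i, Odd (y i)) :
    IsLeast (Set.range fun x : n → ℝ => b₀ + ∑ j, b j * x j ^ (2 * d) + c * ∏ i, x i ^ y i)
      (b₀ * (1 - (|c| / ((b₀ / w₀) ^ w₀ * ∏ j, (b j / w j) ^ w j)) ^ (1 / w₀))) := by
  have hB : ∀ o : Option n, 0 < Option.elim o b₀ b := by
    intro o; cases o <;> simp [hb₀, hb]
  have hW : ∀ o : Option n, 0 < Option.elim o w₀ w := by
    intro o; cases o <;> simp [hw₀, hw]
  have hW1 : ∑ o : Option n, Option.elim o w₀ w = 1 := by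
    rw [Fintype.sum_option]; simpa using hsum
  have ha : ∀ (o : Option n) (i : n),
      Even (Option.elim o (fun _ => 0) (fun j i => if i = j then 2 * d else 0) i) := by
    intro o i; cases o
    · exact ⟨0, rfl⟩
    · simp only [Option.elim_some]
      split_ifs
      · exact ⟨d, by ring⟩
      · exact ⟨0, rfl⟩
  have hβ : ∀ i : n, (y i : ℝ) = ∑ o : Option n, Option.elim o w₀ w
      * ((Option.elim o (fun _ => 0) (fun j i => if i = j then 2 * d else 0) i : ℕ) : ℝ) := by
    intro i
    rw [Fintype.sum_option]
    simp only [Option.elim_none, Option.elim_some, Nat.cast_zero, mul_zero, zero_add]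
    have h : ∀ j : n, w j * ((if i = j then 2 * d else 0 : ℕ) : ℝ)
        = if i = j then w i * (2 * d) else 0 := by
      intro j
      split_ifs with hij
      · subst hij; push_cast; ring
      · simp
    simp_rw [h]
    rw [sum_ite_eq, if_pos (mem_univ i), hy i]
  have hj₀ : ∀ i : n,
      Option.elim (none : Option n) (fun _ => 0) (fun j i => if i = j then 2 * d else 0) i = 0 :=
    fun i => rfl
  have key := isLeast_circuitPolynomial hB hW hW1 ha (affineIndependent_stdSimplex hd) hβ hj₀ hc0
    hprop
  simp_rw [eval_diagonal] at key
  rw [circuitNumber_diagonal] at key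
  simpa using key

/-! ### Instance: `1 + x⁴ + y⁴ + c x y` -/

/-- `Θ = 2^{1/2} · (4^{1/4} · 4^{1/4}) = 2 √2` for `b = (1, 1, 1)`, `λ = (½, ¼, ¼)`. [folklore] -/
private theorem theta_biquadratic :
    ((1 : ℝ) / (1 / 2)) ^ ((1 : ℝ) / 2) * (((1 : ℝ) / (1 / 4)) ^ ((1 : ℝ) / 4)
      * ((1 : ℝ) / (1 / 4)) ^ ((1 : ℝ) / 4)) = 2 * Real.sqrt 2 := by
  have h4 : ((1 : ℝ) / (1 / 4)) ^ ((1 : ℝ) / 4) = 2 ^ ((1 : ℝ) / 2) := by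
    rw [show ((1 : ℝ) / (1 / 4)) = 2 ^ (2 : ℝ) by norm_num, ← Real.rpow_mul (by norm_num)]
    norm_num
  rw [h4, show ((1 : ℝ) / (1 / 2)) = 2 by norm_num, ← Real.rpow_add two_pos,
    ← Real.rpow_add two_pos, Real.sqrt_eq_rpow,
    show ((1 : ℝ) / 2 + ((1 : ℝ) / 2 + 1 / 2)) = 1 + 1 / 2 by norm_num,
    Real.rpow_add two_pos, Real.rpow_one]

/-- **`1 + x⁴ + y⁴ + c x y ≥ 0` on `ℝ²` iff `|c| ≤ 2√2`** — the standard simplex `{0, 4e₁, 4e₂}`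
with inner point `(1,1) = ¼ · 4e₁ + ¼ · 4e₂`, `λ₀ = ½`, `Θ = 2^{1/2} 4^{1/4} 4^{1/4} = 2√2`
(odd inner exponents: two-sided condition).
[cite: IlimanDewolff2016, Theorem 3.8 (n = 2, standard simplex of edge length 4)] -/
theorem one_add_pow_four_add_pow_four_add_mul_nonneg_iff (c : ℝ) :
    (∀ x y : ℝ, 0 ≤ 1 + x ^ 4 + y ^ 4 + c * x * y) ↔ |c| ≤ 2 * Real.sqrt 2 := by
  have h := diagonal_nonneg_iff (n := Fin 2) (b₀ := 1) (b := fun _ => 1) one_pos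
    (fun _ => one_pos) (d := 2) (by norm_num) (y := fun _ => 1) (w₀ := 1 / 2) (w := fun _ => 1 / 4)
    (by norm_num) (fun _ => by norm_num) (by rw [Fin.sum_univ_two]; norm_num)
    (fun _ => by norm_num) c
  simp only [Fin.sum_univ_two, Fin.prod_univ_two, one_mul, pow_one] at h
  rw [theta_biquadratic] at h
  have hodd : ¬ (∀ i : Fin 2, Even ((fun _ : Fin 2 => 1) i)) := fun h' => by
    simpa using h' 0
  rw [or_iff_right (fun h' => hodd h'.2)] at h
  rw [← h]
  constructor
  · intro H x
    have := H (x 0) (x 1)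
    ring_nf at this ⊢
    linarith
  · intro H x y
    have := H ![x, y]
    simp only [cons_val_zero, cons_val_one] at this
    ring_nf at this ⊢
    linarith

end Literature.Algebra.Polynomial.CircuitDiagonalMinusTail
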